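import Summits.Ventures.PercRepro.C025ProfileOneFlatArith
import Summits.Ventures.PercRepro.C025ProfileGirthRows

/-!
# THE SECOND ROW `(q, r−1)` OF (Π) ON «A FAT FLAT PLUS FREE POINTS» — THE MATROID THEOREM (night-3 g24)

`proofs/NIGHT3-G24-ONEFLAT.md` §2–§3.  Let `M` be a finite matroid whose ground set splits as `E₁ ⊔ E₂` with
`|E₂| = m`, and whose rank function is `ρ_M(X) = min(r, ρ₁(X ∩ E₁) + |X ∩ E₂|)` for a function `ρ₁ ≤ s` on the
subsets of `E₁` (the truncation `T_r(M₁ ⊕ U_{m,m})` of the direct sum of a rank-`s` matroid `M₁` on `E₁` with `m`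
coloops is the example; `M₁ = U_{s,k}` gives «`U_{r,n}` with one fat flat» — the first open family of the second row).
Write `W c = #{Y ⊆ E₁ : ρ₁(Y) = c}` for the level profile of `ρ₁`.  If `W c / C(s,c)` is non-decreasing in `c ≤ s`
(every uniform `U_{s,k}`, `k ≥ s`), then for every `q ≤ r − 2` with `r + q ≤ s + m` the row `(q, r−1)` of (Π) holds:

  `Σ_{ρ(B) = q} price(B) ≤ (r/(q+1)) · #R_q ≤ (r/(q+1)) · Σ_c W c · C(m, q−c) ≤ Σ_c W c · C(m, r−1−c) ≤ #{S : ρ(S) = r−1}`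

— the price of every member is at most `r/(q+1)` (its complement has rank `≤ r`), the members inject by
`B ↦ (B ∩ E₁, B ∩ E₂)` into the pairs of a level-`c` set of `E₁` and a `(q−c)`-subset of `E₂`, the pairs of a level-`c`
set and an `(r−1−c)`-subset inject by union into the level `r−1`, and the middle step is `OneFlat.majorize`.

* `price_le_div` — `price ≤ r/(q+1)` for every rank-`q` set when all complements have rank `≤ r`;
* `card_Rq_fiber_le`, `card_Rq_le` — the member count by the level of the `E₁`-part;
* `card_levelSet_fiber_ge`, `card_levelSet_ge` — the level `r−1` by the level of the `E₁`-part;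
* **`profileIneq_second_of_split`** — the theorem; **`rls_of_split`** — C-025 at the corank-2 diagonal `(r, r−2)` for
  `2r − 2 ≤ s + m` (the single row `(r−2, r−1)` through `GirthRows.rls_of_profileIneq_rows`);
* `choose_mul_choose_le_choose_mul_choose`, `card_filter_min_card_eq`, `choose_le_card_filter_min_card_eq`,
  `profile_mono_of_uniform` — the level profile of a UNIFORM flat (`ρ₁(Y) = min(|Y|, s)`) is monotone;
* **`profileIneq_second_of_uniformFlat`**, **`rls_of_uniformFlat`** — «`U_{r,n}` with one fat flat `U_{s,k}`»: the second
  row for `r + q ≤ s + m` and C-025 at `(r, r−2)` for `2r − 2 ≤ s + m`, hypothesis-only (no construction of the matroid).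
No `def`, no `instance`, no notation.  Axioms: standard.
-/

open scoped Matroid

namespace PercRepro

open Finset ThmH

namespace OneFlat

variable {α : Type} [DecidableEq α]

/-- `C(r+q, r−1)/C(r+q, q) = r/(q+1)`. -/
theorem choose_div_choose_tight {r q : ℕ} (hq : q + 1 ≤ r) :
    ((r + q).choose (r - 1) : ℚ) / ((r + q).choose q : ℚ) = (r : ℚ) / ((q : ℚ) + 1) := by
  have hpos : (0 : ℚ) < ((r + q).choose q : ℚ) := by exact_mod_cast Nat.choose_pos (by omega)
  rw [div_eq_div_iff hpos.ne' (by positivity)]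
  exact choose_tight hq

/-- When every complement has rank `≤ r`, the price of a rank-`q` set at level `r−1` is at most `r/(q+1)`. -/
theorem price_le_div {M : Matroid α} [M.Finite] {r q : ℕ} (hq : q + 1 ≤ r)
    (hle : ∀ X : Finset α, X ⊆ gr M → M.eRk (X : Set α) ≤ (r : ℕ∞)) (B : Finset α) :
    Profile.price M q (r - 1) B ≤ (r : ℚ) / ((q : ℚ) + 1) := by
  have hfin : M.eRk ((gr M \ B : Finset α) : Set α) ≠ ⊤ := by
    have := M.eRk_le_eRank ((gr M \ B : Finset α) : Set α)
    exact ne_top_of_le_ne_top (M.eRank_ne_top_iff.2 inferInstance) this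
  obtain ⟨p, hp⟩ : ∃ p : ℕ, M.eRk ((gr M \ B : Finset α) : Set α) = (p : ℕ∞) :=
    ⟨_, (ENat.coe_toNat hfin).symm⟩
  have hpr : p ≤ r := by
    have := hle (gr M \ B) sdiff_subset
    rw [hp] at this
    exact_mod_cast this
  by_cases hup : r - 1 ≤ p
  · rw [PriceMono.price_eq_of_le hp hup, ← choose_div_choose_tight hq]
    exact PriceMono.choose_div_choose_mono (by omega) hup hpr
  · have : Profile.price M q (r - 1) B = 0 := by
      unfold Profile.price
      rw [hp, if_neg (by exact_mod_cast hup)]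
    rw [this]; positivity

section Split

variable (M : Matroid α) [M.Finite] (E₁ E₂ : Finset α) (ρ₁ : Finset α → ℕ) (r : ℕ)

/-- The fibre of the rank-`q` sets with `ρ₁(B ∩ E₁) = c` injects into (level-`c` sets of `E₁`) × (`(q−c)`-subsets of `E₂`). -/
theorem card_Rq_fiber_le (hE : gr M = E₁ ∪ E₂)
    (hrk : ∀ X : Finset α, X ⊆ gr M →
      M.eRk (X : Set α) = ((min r (ρ₁ (X ∩ E₁) + (X ∩ E₂).card) : ℕ) : ℕ∞))
    (q : ℕ) (hq : q < r) (c : ℕ) :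
    ((Profile.Rq M q).filter (fun B => ρ₁ (B ∩ E₁) = c)).card ≤
      ((E₁.powerset).filter (fun Y => ρ₁ Y = c)).card * (E₂.card).choose (q - c) := by
  rw [← card_powersetCard, ← card_product]
  apply card_le_card_of_injOn (fun B => (B ∩ E₁, B ∩ E₂))
  · intro B hB
    simp only [coe_filter, Set.mem_setOf_eq, Profile.mem_Rq] at hB
    obtain ⟨⟨hBg, hBq⟩, hBc⟩ := hB
    rw [hrk B hBg] at hBq
    have hBq' : min r (ρ₁ (B ∩ E₁) + (B ∩ E₂).card) = q := by exact_mod_cast hBq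
    have hsum : ρ₁ (B ∩ E₁) + (B ∩ E₂).card = q := by omega
    simp only [coe_product, Set.mem_prod, coe_filter, mem_powerset, Set.mem_setOf_eq, mem_coe,
      mem_powersetCard]
    exact ⟨⟨inter_subset_right, hBc⟩, inter_subset_right, by omega⟩
  · intro B hB B' hB' hBB'
    simp only [coe_filter, Set.mem_setOf_eq, Profile.mem_Rq] at hB hB'
    simp only [Prod.mk.injEq] at hBB'
    have h1 : B = B ∩ E₁ ∪ B ∩ E₂ := by
      rw [← inter_union_distrib_left, ← hE]
      exact (inter_eq_left.2 hB.1.1).symm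
    have h2 : B' = B' ∩ E₁ ∪ B' ∩ E₂ := by
      rw [← inter_union_distrib_left, ← hE]
      exact (inter_eq_left.2 hB'.1.1).symm
    rw [h1, h2, hBB'.1, hBB'.2]

/-- The number of rank-`q` sets is at most `Σ_{c ≤ q} W c · C(m, q−c)`. -/
theorem card_Rq_le (hE : gr M = E₁ ∪ E₂)
    (hrk : ∀ X : Finset α, X ⊆ gr M →
      M.eRk (X : Set α) = ((min r (ρ₁ (X ∩ E₁) + (X ∩ E₂).card) : ℕ) : ℕ∞))
    (q : ℕ) (hq : q < r) :
    (Profile.Rq M q).card ≤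
      ∑ c ∈ range (q + 1), ((E₁.powerset).filter (fun Y => ρ₁ Y = c)).card * (E₂.card).choose (q - c) := by
  have hmaps : Set.MapsTo (fun B => ρ₁ (B ∩ E₁)) ↑(Profile.Rq M q) ↑(range (q + 1)) := by
    intro B hB
    simp only [mem_coe, Profile.mem_Rq] at hB
    have hBq := hB.2
    rw [hrk B hB.1] at hBq
    have hBq' : min r (ρ₁ (B ∩ E₁) + (B ∩ E₂).card) = q := by exact_mod_cast hBq
    simp only [mem_coe, mem_range]
    omega
  rw [card_eq_sum_card_fiberwise hmaps]
  apply sum_le_sum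
  intro c _
  exact card_Rq_fiber_le M E₁ E₂ ρ₁ r hE hrk q hq c

/-- (Level-`c` sets of `E₁`) × (`(r−1−c)`-subsets of `E₂`) inject by union into the fibre of the level `r−1`
with `ρ₁(S ∩ E₁) = c`. -/
theorem card_levelSet_fiber_ge (hE : gr M = E₁ ∪ E₂) (hdisj : Disjoint E₁ E₂)
    (hrk : ∀ X : Finset α, X ⊆ gr M →
      M.eRk (X : Set α) = ((min r (ρ₁ (X ∩ E₁) + (X ∩ E₂).card) : ℕ) : ℕ∞))
    (c : ℕ) (hc : c < r) :
    ((E₁.powerset).filter (fun Y => ρ₁ Y = c)).card * (E₂.card).choose (r - 1 - c) ≤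
      ((Shadow.levelSet M (r - 1)).filter (fun S => ρ₁ (S ∩ E₁) = c)).card := by
  rw [← card_powersetCard, ← card_product]
  apply card_le_card_of_injOn (fun YZ : Finset α × Finset α => YZ.1 ∪ YZ.2)
  · rintro ⟨Y, Z⟩ hYZ
    simp only [coe_product, Set.mem_prod, coe_filter, mem_powerset, Set.mem_setOf_eq, mem_coe,
      mem_powersetCard] at hYZ
    obtain ⟨⟨hY, hYc⟩, hZ, hZc⟩ := hYZ
    have hYE₁ : (Y ∪ Z) ∩ E₁ = Y := by
      rw [union_inter_distrib_right, inter_eq_left.2 hY,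
        disjoint_iff_inter_eq_empty.1 (disjoint_of_subset_left hZ hdisj.symm), union_empty]
    have hZE₂ : (Y ∪ Z) ∩ E₂ = Z := by
      rw [union_inter_distrib_right, inter_eq_left.2 hZ,
        disjoint_iff_inter_eq_empty.1 (disjoint_of_subset_left hY hdisj), empty_union]
    have hsub : Y ∪ Z ⊆ gr M := by
      rw [hE]; exact union_subset_union hY hZ
    simp only [coe_filter, Set.mem_setOf_eq, Profile.mem_levelSet]
    refine ⟨⟨hsub, ?_⟩, by rw [hYE₁]; exact hYc⟩
    rw [hrk (Y ∪ Z) hsub, hYE₁, hZE₂, hYc, hZc]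
    congr 1
    omega
  · rintro ⟨Y, Z⟩ hYZ ⟨Y', Z'⟩ hYZ' h
    simp only [coe_product, Set.mem_prod, coe_filter, mem_powerset, Set.mem_setOf_eq, mem_coe,
      mem_powersetCard] at hYZ hYZ'
    simp only at h
    have e1 : ∀ (Y Z : Finset α), Y ⊆ E₁ → Z ⊆ E₂ → (Y ∪ Z) ∩ E₁ = Y := by
      intro Y Z hY hZ
      rw [union_inter_distrib_right, inter_eq_left.2 hY,
        disjoint_iff_inter_eq_empty.1 (disjoint_of_subset_left hZ hdisj.symm), union_empty]
    have e2 : ∀ (Y Z : Finset α), Y ⊆ E₁ → Z ⊆ E₂ → (Y ∪ Z) ∩ E₂ = Z := by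
      intro Y Z hY hZ
      rw [union_inter_distrib_right, inter_eq_left.2 hZ,
        disjoint_iff_inter_eq_empty.1 (disjoint_of_subset_left hY hdisj), empty_union]
    have hY : Y = Y' := by
      rw [← e1 Y Z hYZ.1.1 hYZ.2.1, ← e1 Y' Z' hYZ'.1.1 hYZ'.2.1, h]
    have hZ : Z = Z' := by
      rw [← e2 Y Z hYZ.1.1 hYZ.2.1, ← e2 Y' Z' hYZ'.1.1 hYZ'.2.1, h]
    rw [hY, hZ]

/-- The level `r−1` has at least `Σ_{c < r} W c · C(m, r−1−c)` sets. -/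
theorem card_levelSet_ge (hE : gr M = E₁ ∪ E₂) (hdisj : Disjoint E₁ E₂)
    (hrk : ∀ X : Finset α, X ⊆ gr M →
      M.eRk (X : Set α) = ((min r (ρ₁ (X ∩ E₁) + (X ∩ E₂).card) : ℕ) : ℕ∞))
    (hr : 1 ≤ r) :
    ∑ c ∈ range r, ((E₁.powerset).filter (fun Y => ρ₁ Y = c)).card * (E₂.card).choose (r - 1 - c) ≤
      (Shadow.levelSet M (r - 1)).card := by
  have hmaps : Set.MapsTo (fun S => ρ₁ (S ∩ E₁)) ↑(Shadow.levelSet M (r - 1)) ↑(range r) := by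
    intro S hS
    simp only [mem_coe, Profile.mem_levelSet] at hS
    have hSr := hS.2
    rw [hrk S hS.1] at hSr
    have hSr' : min r (ρ₁ (S ∩ E₁) + (S ∩ E₂).card) = r - 1 := by exact_mod_cast hSr
    simp only [mem_coe, mem_range]
    omega
  rw [card_eq_sum_card_fiberwise hmaps]
  apply sum_le_sum
  intro c hc
  exact card_levelSet_fiber_ge M E₁ E₂ ρ₁ r hE hdisj hrk c (mem_range.1 hc)

/-- **THE SECOND ROW ON «A FAT FLAT PLUS FREE POINTS», IN THE SPANNING REGIME.**  `M` finite with
`gr M = E₁ ⊔ E₂`, `ρ_M(X) = min(r, ρ₁(X ∩ E₁) + |X ∩ E₂|)`, `ρ₁ ≤ s` on the subsets of `E₁`, level profile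
`W c = #{Y ⊆ E₁ : ρ₁ Y = c}` with `W c / C(s,c)` non-decreasing on `c ≤ s`; then for `q + 2 ≤ r` and
`r + q ≤ s + |E₂|` the row `(q, r−1)` of (Π) holds. -/
theorem profileIneq_second_of_split (hE : gr M = E₁ ∪ E₂) (hdisj : Disjoint E₁ E₂) (s : ℕ)
    (hρ₁ : ∀ Y : Finset α, Y ⊆ E₁ → ρ₁ Y ≤ s)
    (hrk : ∀ X : Finset α, X ⊆ gr M →
      M.eRk (X : Set α) = ((min r (ρ₁ (X ∩ E₁) + (X ∩ E₂).card) : ℕ) : ℕ∞))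
    (hmono : ∀ c' c, c' ≤ c → c ≤ s →
      ((E₁.powerset).filter (fun Y => ρ₁ Y = c')).card * s.choose c ≤
        ((E₁.powerset).filter (fun Y => ρ₁ Y = c)).card * s.choose c')
    (q : ℕ) (hq : q + 2 ≤ r) (hreg : r + q ≤ s + E₂.card) :
    Profile.ProfileIneq M q (r - 1) := by
  unfold Profile.ProfileIneq
  have hle : ∀ X : Finset α, X ⊆ gr M → M.eRk (X : Set α) ≤ (r : ℕ∞) := by
    intro X hX
    rw [hrk X hX]
    exact_mod_cast min_le_left _ _
  -- (A) every price is at most `r/(q+1)`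
  have hA : ∑ B ∈ Profile.Rq M q, Profile.price M q (r - 1) B ≤
      ((Profile.Rq M q).card : ℚ) * ((r : ℚ) / ((q : ℚ) + 1)) := by
    rw [card_eq_sum_ones, Nat.cast_sum, sum_mul]
    apply sum_le_sum
    intro B _
    rw [Nat.cast_one, one_mul]
    exact price_le_div (by omega) hle B
  -- (B) the member count
  have hB := card_Rq_le M E₁ E₂ ρ₁ r hE hrk q (by omega)
  -- (C) the level count
  have hC := card_levelSet_ge M E₁ E₂ ρ₁ r hE hdisj hrk (by omega)
  -- (D) the arithmetic theorem
  have hW : ∀ c, s < c → ((E₁.powerset).filter (fun Y => ρ₁ Y = c)).card = 0 := by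
    intro c hc
    rw [card_eq_zero, filter_eq_empty_iff]
    intro Y hY hYc
    have := hρ₁ Y (mem_powerset.1 hY)
    omega
  have hD := majorize (fun c => ((E₁.powerset).filter (fun Y => ρ₁ Y = c)).card) s E₂.card r q hq hreg hW hmono
  -- assemble
  have hq1 : (0 : ℚ) < (q : ℚ) + 1 := by positivity
  have hB' : ((Profile.Rq M q).card : ℚ) ≤
      ∑ c ∈ range (q + 1), (((E₁.powerset).filter (fun Y => ρ₁ Y = c)).card : ℚ) * ((E₂.card).choose (q - c) : ℚ) := by
    exact_mod_cast hB
  have hC' : ∑ c ∈ range r, (((E₁.powerset).filter (fun Y => ρ₁ Y = c)).card : ℚ) * ((E₂.card).choose (r - 1 - c) : ℚ) ≤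
      ((Shadow.levelSet M (r - 1)).card : ℚ) := by
    exact_mod_cast hC
  calc ∑ B ∈ Profile.Rq M q, Profile.price M q (r - 1) B
      ≤ ((Profile.Rq M q).card : ℚ) * ((r : ℚ) / ((q : ℚ) + 1)) := hA
    _ ≤ (∑ c ∈ range (q + 1), (((E₁.powerset).filter (fun Y => ρ₁ Y = c)).card : ℚ) *
          ((E₂.card).choose (q - c) : ℚ)) * ((r : ℚ) / ((q : ℚ) + 1)) := by
        apply mul_le_mul_of_nonneg_right hB' (by positivity)
    _ ≤ ∑ c ∈ range r, (((E₁.powerset).filter (fun Y => ρ₁ Y = c)).card : ℚ) *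
          ((E₂.card).choose (r - 1 - c) : ℚ) := by
        rw [mul_div_assoc', div_le_iff₀ hq1]
        linarith [hD]
    _ ≤ ((Shadow.levelSet M (r - 1)).card : ℚ) := hC'

/-- **C-025 at the corank-2 diagonal `(r, r−2)` on «a fat flat plus free points»** for `2r − 2 ≤ s + |E₂|`: the single
row `(r−2, r−1)` through the pointwise bridge. -/
theorem rls_of_split (hE : gr M = E₁ ∪ E₂) (hdisj : Disjoint E₁ E₂) (s : ℕ)
    (hρ₁ : ∀ Y : Finset α, Y ⊆ E₁ → ρ₁ Y ≤ s)
    (hrk : ∀ X : Finset α, X ⊆ gr M →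
      M.eRk (X : Set α) = ((min r (ρ₁ (X ∩ E₁) + (X ∩ E₂).card) : ℕ) : ℕ∞))
    (hmono : ∀ c' c, c' ≤ c → c ≤ s →
      ((E₁.powerset).filter (fun Y => ρ₁ Y = c')).card * s.choose c ≤
        ((E₁.powerset).filter (fun Y => ρ₁ Y = c)).card * s.choose c')
    (hr : 2 ≤ r) (hreg : 2 * r ≤ s + E₂.card + 2) :
    ThmN.RLS M r (r - 2) := by
  apply GirthRows.rls_of_profileIneq_rows
  intro u hu1 hu2
  have hu : u = r - 1 := by omega
  subst hu
  exact profileIneq_second_of_split M E₁ E₂ ρ₁ r hE hdisj s hρ₁ hrk hmono (r - 2) (by omega) (by omega)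

end Split

section UniformFlat

/-- `C(k,c')·C(s,c) ≤ C(k,c)·C(s,c')` for `c' ≤ c ≤ s ≤ k`: the binomial profile of `U_{s,k}` grows at least as
fast as that of the free matroid `U_{s,s}`. -/
theorem choose_mul_choose_le_choose_mul_choose {k s c' c : ℕ} (hc'c : c' ≤ c) (hcs : c ≤ s) (hsk : s ≤ k) :
    k.choose c' * s.choose c ≤ k.choose c * s.choose c' := by
  induction c, hc'c using Nat.le_induction with
  | base => exact le_rfl
  | succ c hc'c ih =>
    have ih' := ih (by omega)
    have h1 := Nat.choose_succ_right_eq s c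
    have h2 := Nat.choose_succ_right_eq k c
    have hsc : s - c ≤ k - c := by omega
    apply Nat.le_of_mul_le_mul_right (c := c + 1) _ (by omega)
    calc k.choose c' * s.choose (c + 1) * (c + 1) = k.choose c' * (s.choose (c + 1) * (c + 1)) := by ring
      _ = k.choose c' * (s.choose c * (s - c)) := by rw [h1]
      _ = (k.choose c' * s.choose c) * (s - c) := by ring
      _ ≤ (k.choose c * s.choose c') * (s - c) := Nat.mul_le_mul_right _ ih'
      _ ≤ (k.choose c * s.choose c') * (k - c) := Nat.mul_le_mul_left _ hsc
      _ = (k.choose c * (k - c)) * s.choose c' := by ring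
      _ = (k.choose (c + 1) * (c + 1)) * s.choose c' := by rw [h2]
      _ = k.choose (c + 1) * s.choose c' * (c + 1) := by ring

variable (E₁ : Finset α) (s : ℕ)

omit [DecidableEq α] in
/-- Below the rank, the level `c < s` of the uniform profile `min(|Y|, s)` is the `c`-subsets. -/
theorem card_filter_min_card_eq {c : ℕ} (hc : c < s) :
    ((E₁.powerset).filter (fun Y => min Y.card s = c)).card = E₁.card.choose c := by
  rw [← card_powersetCard, powersetCard_eq_filter]
  congr 1
  apply filter_congr
  intro Y _
  constructor
  · intro h
    rcases Nat.lt_or_ge Y.card s with h' | h'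
    · rw [min_eq_left h'.le] at h; exact h
    · rw [min_eq_right h'] at h; omega
  · intro h
    rw [h, min_eq_left hc.le]

omit [DecidableEq α] in
/-- The top level `s` of the uniform profile contains the `s`-subsets. -/
theorem choose_le_card_filter_min_card_eq :
    E₁.card.choose s ≤ ((E₁.powerset).filter (fun Y => min Y.card s = s)).card := by
  rw [← card_powersetCard]
  apply card_le_card
  intro Y hY
  rw [mem_powersetCard] at hY
  rw [mem_filter, mem_powerset]
  exact ⟨hY.1, by rw [hY.2, min_self]⟩

omit [DecidableEq α] in
/-- The level profile of a uniform flat `U_{s,k}` (`k ≥ s`) is monotone in the sense of `majorize`. -/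
theorem profile_mono_of_uniform (hsk : s ≤ E₁.card) (c' c : ℕ) (hc'c : c' ≤ c) (hcs : c ≤ s) :
    ((E₁.powerset).filter (fun Y => min Y.card s = c')).card * s.choose c ≤
      ((E₁.powerset).filter (fun Y => min Y.card s = c)).card * s.choose c' := by
  rcases Nat.lt_or_ge c s with hc | hc
  · rw [card_filter_min_card_eq E₁ s hc, card_filter_min_card_eq E₁ s (by omega)]
    exact choose_mul_choose_le_choose_mul_choose hc'c hcs hsk
  · have hcs' : c = s := by omega
    subst hcs'
    rcases Nat.lt_or_ge c' c with hc' | hc'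
    · rw [card_filter_min_card_eq E₁ c hc', Nat.choose_self, mul_one]
      have h1 := choose_le_card_filter_min_card_eq E₁ c
      have h2 := Nat.choose_mul (n := E₁.card) (k := c) (s := c') hc'.le
      have h3 : 1 ≤ (E₁.card - c').choose (c - c') := Nat.choose_pos (by omega)
      calc E₁.card.choose c' = E₁.card.choose c' * 1 := (mul_one _).symm
        _ ≤ E₁.card.choose c' * (E₁.card - c').choose (c - c') := Nat.mul_le_mul_left _ h3
        _ = E₁.card.choose c * c.choose c' := h2.symm
        _ ≤ ((E₁.powerset).filter (fun Y => min Y.card c = c)).card * c.choose c' :=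
          Nat.mul_le_mul_right _ h1
    · have : c' = c := by omega
      subst this
      exact le_rfl

variable (M : Matroid α) [M.Finite] (E₂ : Finset α) (r : ℕ)

/-- **THE SECOND ROW ON «`U_{r,n}` WITH ONE FAT FLAT `U_{s,k}`»** (`k ≥ s`), in the spanning regime `r + q ≤ s + m`:
`M` finite, `gr M = E₁ ⊔ E₂`, `ρ_M(X) = min(r, min(|X ∩ E₁|, s) + |X ∩ E₂|)`. -/
theorem profileIneq_second_of_uniformFlat (hE : gr M = E₁ ∪ E₂) (hdisj : Disjoint E₁ E₂)
    (hsk : s ≤ E₁.card)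
    (hrk : ∀ X : Finset α, X ⊆ gr M →
      M.eRk (X : Set α) = ((min r (min (X ∩ E₁).card s + (X ∩ E₂).card) : ℕ) : ℕ∞))
    (q : ℕ) (hq : q + 2 ≤ r) (hreg : r + q ≤ s + E₂.card) :
    Profile.ProfileIneq M q (r - 1) :=
  profileIneq_second_of_split M E₁ E₂ (fun Y => min Y.card s) r hE hdisj s
    (fun _ _ => min_le_right _ _) hrk (fun c' c hc'c hcs => profile_mono_of_uniform E₁ s hsk c' c hc'c hcs)
    q hq hreg

/-- **C-025 at `(r, r−2)` on «`U_{r,n}` with one fat flat `U_{s,k}`»** for `2r − 2 ≤ s + m`. -/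
theorem rls_of_uniformFlat (hE : gr M = E₁ ∪ E₂) (hdisj : Disjoint E₁ E₂)
    (hsk : s ≤ E₁.card)
    (hrk : ∀ X : Finset α, X ⊆ gr M →
      M.eRk (X : Set α) = ((min r (min (X ∩ E₁).card s + (X ∩ E₂).card) : ℕ) : ℕ∞))
    (hr : 2 ≤ r) (hreg : 2 * r ≤ s + E₂.card + 2) :
    ThmN.RLS M r (r - 2) :=
  rls_of_split M E₁ E₂ (fun Y => min Y.card s) r hE hdisj s (fun _ _ => min_le_right _ _) hrk
    (fun c' c hc'c hcs => profile_mono_of_uniform E₁ s hsk c' c hc'c hcs) hr hreg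

end UniformFlat

end OneFlat

end PercRepro
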